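import Mathlib
import Summits.QuantumFields.QCD.Theorems.WilsonQuarkChessboardBackgroundSchwarzPlane

/-!
# The reflection doubles of a link field (helper for `BackgroundSchwarz`)

Field-level bookkeeping for the positive double `U⁺⁺ = (pos ? U : ΘU)` and the negative double
`U⁻⁻ = (pos ? ΘU : U)` of the item `BackgroundSchwarz` (given through their pointwise description,
so that no decidability instance of the item is fixed here): the site reflection `Θcfg` is an
involution, both doubles are reflection symmetric in the sense needed by the reflection identity
(`U = Θcfg[U⁺⁺]` and `U⁻⁻ = Θcfg[U⁻⁻]` on the closed positive half), and all three fields have the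
same spatial links inside the two reflection hyperplanes `x₀ = 0, L/2`.
-/

noncomputable section

namespace Summit.QuantumFields.QCD.Theorems.BackgroundSchwarz

open Matrix Complex Finset
open Literature.MathematicalPhysics Literature.MathematicalPhysics.QuantumLattice
  Literature.MathematicalPhysics.QuantumFieldTheory Literature.Probability.LatticeModels

variable {L N : ℕ} [NeZero L]

local notation "𝕌" => Matrix.unitaryGroup (Fin N) ℂ

section Doubles

omit [NeZero L] in
/-- Every edge is `(Fin.cons t xs, 0)` or `(Fin.cons t xs, k.succ)`. -/
theorem edge_cases (P : Edge 4 L → Prop)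
    (h0 : ∀ (t : ZMod L) (xs : Fin 3 → ZMod L), P ((Fin.cons t xs : TorusSite 4 L), 0))
    (hs : ∀ (t : ZMod L) (xs : Fin 3 → ZMod L) (k : Fin 3), P ((Fin.cons t xs : TorusSite 4 L), k.succ))
    (e : Edge 4 L) : P e := by
  obtain ⟨x, μ⟩ := e
  rw [← cons_self x]
  refine Fin.cases ?_ (fun k => ?_) μ
  · exact h0 _ _
  · exact hs _ _ k

/-- A time-like link of the positive half reflects to a link of the negative half. -/
theorem not_posE_reflect_zero [Fact (1 < L)] (hL2 : 2 * (L / 2) = L) {t : ZMod L} (ht : t.val < L / 2)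
    (xs : Fin 3 → ZMod L) :
    ¬posE[L, (((Fin.cons (-(t + 1)) xs : TorusSite 4 L), (0 : Fin 4)) : Edge 4 L)] := by
  have := ZMod.val_lt t
  rw [posE_cons_zero, not_lt, val_neg_eq, val_add_one, if_neg (show ¬(t.val + 1 = L) by omega),
    if_neg (show ¬(t.val + 1 = 0) by omega)]
  omega

/-- A spatial link of the positive half either lies in a reflection hyperplane (and is fixed by the
reflection) or reflects to a link of the negative half. -/
theorem reflect_succ_dichotomy (hL2 : 2 * (L / 2) = L) {t : ZMod L} (ht : t.val ≤ L / 2) :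
    -t = t ∨ ¬(-t).val ≤ L / 2 := by
  have := ZMod.val_lt t
  by_cases h : t.val = 0 ∨ t.val = L / 2
  · left
    rw [zmod_eq_iff_val, val_neg_eq]
    split_ifs with h1 <;> omega
  · right
    rw [val_neg_eq]
    split_ifs with h1 <;> omega

/-- **The positive double is reflection symmetric**: `U = Θcfg[U⁺⁺]` on the closed positive half. -/
theorem eq_Θcfg_pp [Fact (1 < L)] (hL2 : 2 * (L / 2) = L) (U Upp : GaugeConfig 4 L 𝕌)
    (hUpp_pos : ∀ e : Edge 4 L, posE[L, e] → Upp e = U e)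
    (hUpp_neg : ∀ e : Edge 4 L, ¬posE[L, e] → Upp e = Θcfg[U] e) :
    ∀ e : Edge 4 L, posE[L, e] → U e = Θcfg[Upp] e := by
  refine edge_cases _ (fun t xs ht => ?_) (fun t xs k ht => ?_)
  · rw [posE_cons_zero] at ht
    rw [Θcfg_cons_zero, hUpp_neg _ (not_posE_reflect_zero hL2 ht xs), Θcfg_cons_zero]
    rw [show -(-(t + 1) + 1) = t by ring, inv_inv]
  · rw [posE_cons_succ] at ht
    rw [Θcfg_cons_succ]
    rcases reflect_succ_dichotomy hL2 ht with h | h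
    · rw [h, hUpp_pos _ ((posE_cons_succ _ _ _).2 ht)]
    · rw [hUpp_neg _ (by rwa [posE_cons_succ]), Θcfg_cons_succ, neg_neg]

/-- **The negative double is reflection symmetric**: `U⁻⁻ = Θcfg[U⁻⁻]` on the closed positive half. -/
theorem mm_eq_Θcfg_mm [Fact (1 < L)] (hL2 : 2 * (L / 2) = L) (U Umm : GaugeConfig 4 L 𝕌)
    (hUmm_pos : ∀ e : Edge 4 L, posE[L, e] → Umm e = Θcfg[U] e)
    (hUmm_neg : ∀ e : Edge 4 L, ¬posE[L, e] → Umm e = U e) :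
    ∀ e : Edge 4 L, posE[L, e] → Umm e = Θcfg[Umm] e := by
  refine edge_cases _ (fun t xs ht => ?_) (fun t xs k ht => ?_)
  · have ht' := (posE_cons_zero t xs).1 ht
    rw [hUmm_pos _ ht, Θcfg_cons_zero, Θcfg_cons_zero, hUmm_neg _ (not_posE_reflect_zero hL2 ht' xs)]
  · have ht' := (posE_cons_succ t xs k).1 ht
    rw [Θcfg_cons_succ]
    rcases reflect_succ_dichotomy hL2 ht' with h | h
    · rw [h]
    · rw [hUmm_pos _ ht, hUmm_neg _ (by rwa [posE_cons_succ]), Θcfg_cons_succ]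

omit [NeZero L] in
/-- A field agreeing with `U` on the positive half has the spatial links of `U` in the hyperplanes. -/
theorem pp_plane (U Upp : GaugeConfig 4 L 𝕌) (hUpp_pos : ∀ e : Edge 4 L, posE[L, e] → Upp e = U e)
    {t : ZMod L} (ht : t.val ≤ L / 2) (xs : Fin 3 → ZMod L) (k : Fin 3) :
    Upp ((Fin.cons t xs : TorusSite 4 L), k.succ) = U ((Fin.cons t xs : TorusSite 4 L), k.succ) :=
  hUpp_pos _ ((posE_cons_succ _ _ _).2 ht)

omit [NeZero L] in
/-- The negative double has the spatial links of `U` in the hyperplanes `t = -t`. -/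
theorem mm_plane (U Umm : GaugeConfig 4 L 𝕌) (hUmm_pos : ∀ e : Edge 4 L, posE[L, e] → Umm e = Θcfg[U] e)
    {t : ZMod L} (ht : t.val ≤ L / 2) (htt : -t = t) (xs : Fin 3 → ZMod L) (k : Fin 3) :
    Umm ((Fin.cons t xs : TorusSite 4 L), k.succ) = U ((Fin.cons t xs : TorusSite 4 L), k.succ) := by
  rw [hUmm_pos _ ((posE_cons_succ _ _ _).2 ht), Θcfg_cons_succ, htt]

end Doubles

end Summit.QuantumFields.QCD.Theorems.BackgroundSchwarz
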